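import Mathlib
import HarnessLib

/-!
# Classical replica coupling (A) — decomp-qadv lens-3 («MagnitudeDial» line), generation 29, part 1/2

Light adaptive CLASSICAL query algorithms cannot concentrate their final query on an
oracle-dependent cell: the kernel form of the classical heavy-block law of the MagnitudeDial line
(node record `run/shared/lean/pub/decomp-qadv/decomp-qadv-lens-3/g29/`, CLASSICAL-HBR.md Theorem 1),
in a self-contained combinatorial model (Mathlib only):

* an oracle is `y : Fin N → Bool`; a (deterministic, adaptive) query strategy is a map
  `List Bool → Fin N` giving the next position from the answers received so far; a randomized
  query algorithm is a family `A : σ → Strategy N` over a finite seed type `σ` (uniform seed);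
* `pos (A s) y ℓ` is the position of query number `ℓ` (0-indexed) of seed `s` on oracle `y`;
  queries `0, …, T-1` are "revealed", query `T` is the final one;
* `cnt A ℓ j = #{(s, y) : pos (A s) y ℓ = j}`; the LIGHTNESS hypothesis is
  `cnt A ℓ j ≤ λ · |σ| · 2^N` for all `ℓ ≤ T` and all `j` (every query's position marginal is `≤ λ`);
* `coll A T = #{(s, s', y) : pos (A s) y T = pos (A s') y T}` `= |σ|² · Σ_y Σ_j p_y(j)²`,
  where `p_y(j) = P_s[pos (A s) y T = j]`.

**Theorem `classical_pair_collision` (this part):** `coll A T ≤ λ (1 + T²) |σ|² 2^N`, i.e.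
`E_y Σ_j p_y(j)² ≤ λ (1 + T²)`.  Part B: all moments, `E_y Σ_j p_y(j)^m ≤ λ^{m-1} ∏_{i<m} (1 + i T²)`.

Proof = lazy sampling from independent sources, made finite: for a fixed seed `s`, the map
`Φ_s (yA, yB) = (glue, mix)` — `glue` takes `yA`'s values on the positions `s` reveals when run on
`yA` and `yB`'s values elsewhere, `mix` the other way round — is an INVOLUTION of
`Oracle × Oracle` (`Phi_involutive`), so `Σ_{yA,yB} f(glue yA yB) = 2^N Σ_y f(y)` (`sum_glue`);
on the glued oracle seed `s` runs exactly as on `yA` (`pos_glue_left`), and seed `s'` runs exactly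
as its FREE run on `yB` unless that free run queries a position revealed by `s`
(`pos_glue_right`); the free collision term is `Σ_j cnt_T(j)² ≤ λ|σ|2^N · |σ|2^N` and the
attachment term is `≤ |σ|2^N · T · T · λ|σ|2^N`.  The `T²` charge is necessary (Pollard-rho
coalescence).  No statement of the tree is restated; nothing here is specific to quantum circuits.
-/

set_option linter.dupNamespace false

namespace Summit.QuantumAdvantage.QuantumAdvantage.Theorems.ClassicalReplica

open Finset

variable {N : ℕ}

/-- An oracle on `N` bits. -/
abbrev Oracle (N : ℕ) : Type := Fin N → Bool

/-- An adaptive deterministic query strategy: the next position, given the answers so far. -/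
abbrev Strategy (N : ℕ) : Type := List Bool → Fin N

/-- The answers received by the queries `0, …, ℓ-1`. -/
def answers (A : Strategy N) (y : Oracle N) : ℕ → List Bool
  | 0 => []
  | ℓ + 1 => answers A y ℓ ++ [y (A (answers A y ℓ))]

/-- The position of query number `ℓ` (0-indexed). -/
def pos (A : Strategy N) (y : Oracle N) (ℓ : ℕ) : Fin N := A (answers A y ℓ)

/-- The positions read by the queries `0, …, T-1`. -/
def readSet (A : Strategy N) (y : Oracle N) (T : ℕ) : Finset (Fin N) :=
  (Finset.range T).image (pos A y)

/-- At most `T` positions are read by the first `T` queries. -/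
theorem card_readSet_le (A : Strategy N) (y : Oracle N) (T : ℕ) :
    (readSet A y T).card ≤ T :=
  Finset.card_image_le.trans (by simp)

/-- The position of query `i < T` belongs to the read set. -/
theorem pos_mem_readSet (A : Strategy N) (y : Oracle N) {T i : ℕ} (hi : i < T) :
    pos A y i ∈ readSet A y T :=
  Finset.mem_image.2 ⟨i, Finset.mem_range.2 hi, rfl⟩

/-- If `y'` agrees with `y` on the positions that `y`'s run reads before query `ℓ`, the two runs
receive the same answers up to query `ℓ`. -/
theorem answers_congr (A : Strategy N) (y y' : Oracle N) :
    ∀ ℓ : ℕ, (∀ i < ℓ, y' (pos A y i) = y (pos A y i)) → answers A y' ℓ = answers A y ℓ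
  | 0, _ => rfl
  | ℓ + 1, h => by
      have ih : answers A y' ℓ = answers A y ℓ :=
        answers_congr A y y' ℓ fun i hi => h i (Nat.lt_succ_of_lt hi)
      have hℓ : y' (A (answers A y ℓ)) = y (A (answers A y ℓ)) := h ℓ (Nat.lt_succ_self ℓ)
      show answers A y' ℓ ++ [y' (A (answers A y' ℓ))] = answers A y ℓ ++ [y (A (answers A y ℓ))]
      rw [ih, hℓ]

/-- Two oracles agreeing on the positions of queries `< ℓ` produce the same query `ℓ`. -/
theorem pos_congr (A : Strategy N) (y y' : Oracle N) (ℓ : ℕ)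
    (h : ∀ i < ℓ, y' (pos A y i) = y (pos A y i)) : pos A y' ℓ = pos A y ℓ := by
  show A (answers A y' ℓ) = A (answers A y ℓ)
  rw [answers_congr A y y' ℓ h]

/-- Two oracles agreeing on the positions of queries `< T` have the same read set. -/
theorem readSet_congr (A : Strategy N) (y y' : Oracle N) (T : ℕ)
    (h : ∀ i < T, y' (pos A y i) = y (pos A y i)) : readSet A y' T = readSet A y T := by
  have hp : ∀ i < T, pos A y' i = pos A y i := fun i hi =>
    pos_congr A y y' i fun i' hi' => h i' (hi'.trans hi)
  ext j
  simp only [readSet, Finset.mem_image, Finset.mem_range]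
  constructor
  · rintro ⟨i, hi, rfl⟩
    exact ⟨i, hi, (hp i hi).symm⟩
  · rintro ⟨i, hi, rfl⟩
    exact ⟨i, hi, hp i hi⟩

/-- The glued oracle: `yA` on the positions seed-strategy `A` reveals when run on `yA`,
`yB` elsewhere. -/
def glue (A : Strategy N) (T : ℕ) (yA yB : Oracle N) : Oracle N :=
  fun j => if j ∈ readSet A yA T then yA j else yB j

/-- The complementary mixture (the unused source bits). -/
def mix (A : Strategy N) (T : ℕ) (yA yB : Oracle N) : Oracle N :=
  fun j => if j ∈ readSet A yA T then yB j else yA j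

/-- The read set is stable under gluing (the revealer runs on the glued oracle as on `yA`). -/
theorem readSet_glue (A : Strategy N) (T : ℕ) (yA yB : Oracle N) :
    readSet A (glue A T yA yB) T = readSet A yA T :=
  readSet_congr A yA _ T fun i hi => by
    show (if pos A yA i ∈ readSet A yA T then yA (pos A yA i) else yB (pos A yA i))
        = yA (pos A yA i)
    rw [if_pos (pos_mem_readSet A yA hi)]

/-- On the glued oracle the revealing strategy runs exactly as on `yA`, through query `T`. -/
theorem pos_glue_left (A : Strategy N) (T : ℕ) (yA yB : Oracle N) {ℓ : ℕ} (hℓ : ℓ ≤ T) :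
    pos A (glue A T yA yB) ℓ = pos A yA ℓ :=
  pos_congr A yA _ ℓ fun i hi => by
    show (if pos A yA i ∈ readSet A yA T then yA (pos A yA i) else yB (pos A yA i))
        = yA (pos A yA i)
    rw [if_pos (pos_mem_readSet A yA (lt_of_lt_of_le hi hℓ))]

/-- On the glued oracle a second strategy runs exactly as its FREE run on `yB`, through query
`T`, unless the free run queries a revealed position ("attaches"). -/
theorem pos_glue_right (A B : Strategy N) (T : ℕ) (yA yB : Oracle N)
    (h : ∀ i < T, pos B yB i ∉ readSet A yA T) :
    pos B (glue A T yA yB) T = pos B yB T :=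
  pos_congr B yB _ T fun i hi => by
    show (if pos B yB i ∈ readSet A yA T then yA (pos B yB i) else yB (pos B yB i))
        = yB (pos B yB i)
    rw [if_neg (h i hi)]

/-- The coupling map `(yA, yB) ↦ (glue, mix)`. -/
def Phi (A : Strategy N) (T : ℕ) (p : Oracle N × Oracle N) : Oracle N × Oracle N :=
  (glue A T p.1 p.2, mix A T p.1 p.2)

/-- The coupling map is an involution (hence a bijection of `Oracle × Oracle`). -/
theorem Phi_involutive (A : Strategy N) (T : ℕ) : Function.Involutive (Phi A T) := by
  rintro ⟨yA, yB⟩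
  have hR : readSet A (glue A T yA yB) T = readSet A yA T := readSet_glue A T yA yB
  simp only [Phi, Prod.mk.injEq]
  refine ⟨?_, ?_⟩
  · funext j
    show (if j ∈ readSet A (glue A T yA yB) T then glue A T yA yB j else mix A T yA yB j) = yA j
    rw [hR]
    by_cases hj : j ∈ readSet A yA T
    · rw [if_pos hj]
      show (if j ∈ readSet A yA T then yA j else yB j) = yA j
      rw [if_pos hj]
    · rw [if_neg hj]
      show (if j ∈ readSet A yA T then yB j else yA j) = yA j
      rw [if_neg hj]
  · funext j
    show (if j ∈ readSet A (glue A T yA yB) T then mix A T yA yB j else glue A T yA yB j) = yB j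
    rw [hR]
    by_cases hj : j ∈ readSet A yA T
    · rw [if_pos hj]
      show (if j ∈ readSet A yA T then yB j else yA j) = yB j
      rw [if_pos hj]
    · rw [if_neg hj]
      show (if j ∈ readSet A yA T then yA j else yB j) = yB j
      rw [if_neg hj]

/-- There are `2^N` oracles. -/
theorem card_oracle : Fintype.card (Oracle N) = 2 ^ N := by
  simp

/-- Lazy sampling, finite form: summing `f` over glued oracles of independent sources is
`2^N` times summing `f` over oracles. -/
theorem sum_glue (A : Strategy N) (T : ℕ) (f : Oracle N → ℝ) :
    ∑ yA : Oracle N, ∑ yB : Oracle N, f (glue A T yA yB) = (2 : ℝ) ^ N * ∑ y : Oracle N, f y := by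
  have h1 : ∑ yA : Oracle N, ∑ yB : Oracle N, f (glue A T yA yB)
      = ∑ p : Oracle N × Oracle N, f (Phi A T p).1 :=
    (Fintype.sum_prod_type' (fun a b => f (glue A T a b))).symm
  have h2 : ∑ p : Oracle N × Oracle N, f (Phi A T p).1 = ∑ p : Oracle N × Oracle N, f p.1 :=
    Equiv.sum_comp (Function.Involutive.toPerm (Phi A T) (Phi_involutive A T)) (fun q => f q.1)
  have h3 : ∑ p : Oracle N × Oracle N, f p.1 = ∑ y : Oracle N, ∑ _z : Oracle N, f y :=
    Fintype.sum_prod_type' (fun a _ => f a)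
  rw [h1, h2, h3, Finset.mul_sum]
  refine Finset.sum_congr rfl fun y _ => ?_
  rw [Finset.sum_const, Finset.card_univ, card_oracle, nsmul_eq_mul]
  push_cast
  ring

variable {σ : Type} [Fintype σ]

/-- `#{(s, y) : query ℓ of seed s on y reads position j}` (as a real number). -/
def cnt (A : σ → Strategy N) (ℓ : ℕ) (j : Fin N) : ℝ :=
  ∑ s : σ, ∑ y : Oracle N, if pos (A s) y ℓ = j then 1 else 0

/-- `#{(s, s', y) : the final queries (number T) of seeds s, s' on y read the same position}`
`= |σ|² · Σ_y Σ_j p_y(j)²`. -/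
def coll (A : σ → Strategy N) (T : ℕ) : ℝ :=
  ∑ s : σ, ∑ s' : σ, ∑ y : Oracle N, if pos (A s) y T = pos (A s') y T then 1 else 0

/-- Counts are nonnegative. -/
theorem cnt_nonneg (A : σ → Strategy N) (ℓ : ℕ) (j : Fin N) : 0 ≤ cnt A ℓ j :=
  Finset.sum_nonneg fun _ _ => Finset.sum_nonneg fun _ _ => by split_ifs <;> norm_num

/-- **Classical pair-collision bound** (CLASSICAL-HBR.md, Theorem 1 with `m = 2`): if every
query's position marginal is `≤ λ`, two independent runs on the same uniform oracle make their
final query at the same position with probability `≤ λ (1 + T²)`, `T` = the number of earlier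
queries. -/
theorem classical_pair_collision (A : σ → Strategy N) (T : ℕ) (lam : ℝ) (hlam : 0 ≤ lam)
    (hlight : ∀ ℓ ≤ T, ∀ j : Fin N, cnt A ℓ j ≤ lam * Fintype.card σ * 2 ^ N) :
    coll A T ≤ lam * (1 + (T : ℝ) ^ 2) * (Fintype.card σ : ℝ) ^ 2 * 2 ^ N := by
  classical
  -- abbreviations
  set L : ℝ := lam * Fintype.card σ * 2 ^ N with hL_def
  have hLnn : 0 ≤ L := by rw [hL_def]; positivity
  -- (1) pointwise bound on the glued oracle: free collision or attachment
  have hpt : ∀ (s s' : σ) (yA yB : Oracle N),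
      (if pos (A s) (glue (A s) T yA yB) T = pos (A s') (glue (A s) T yA yB) T then (1:ℝ) else 0)
        ≤ (if pos (A s) yA T = pos (A s') yB T then (1:ℝ) else 0)
          + ∑ i ∈ Finset.range T,
              (if pos (A s') yB i ∈ readSet (A s) yA T then (1:ℝ) else 0) := by
    intro s s' yA yB
    have hsum_nonneg : 0 ≤ ∑ i ∈ Finset.range T,
        (if pos (A s') yB i ∈ readSet (A s) yA T then (1:ℝ) else 0) :=
      Finset.sum_nonneg fun i _ => by split_ifs <;> norm_num
    by_cases hatt : ∃ i < T, pos (A s') yB i ∈ readSet (A s) yA T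
    · obtain ⟨i, hi, hmem⟩ := hatt
      have h1 : (1:ℝ) ≤ ∑ i ∈ Finset.range T,
          (if pos (A s') yB i ∈ readSet (A s) yA T then (1:ℝ) else 0) := by
        have := Finset.single_le_sum
          (f := fun i => (if pos (A s') yB i ∈ readSet (A s) yA T then (1:ℝ) else 0))
          (fun i _ => by
            show (0:ℝ) ≤ (if pos (A s') yB i ∈ readSet (A s) yA T then (1:ℝ) else 0)
            split_ifs <;> norm_num)
          (Finset.mem_range.2 hi)
        simpa [hmem] using this
      have hle1 : (if pos (A s) (glue (A s) T yA yB) T = pos (A s') (glue (A s) T yA yB) T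
          then (1:ℝ) else 0) ≤ 1 := by split_ifs <;> norm_num
      have h0 : 0 ≤ (if pos (A s) yA T = pos (A s') yB T then (1:ℝ) else 0) := by
        split_ifs <;> norm_num
      linarith
    · push Not at hatt
      rw [pos_glue_left (A s) T yA yB le_rfl, pos_glue_right (A s) (A s') T yA yB hatt]
      linarith
  -- (2) the coupling identity
  have hkey : (2:ℝ) ^ N * coll A T
      = ∑ s : σ, ∑ s' : σ, ∑ yA : Oracle N, ∑ yB : Oracle N,
          (if pos (A s) (glue (A s) T yA yB) T = pos (A s') (glue (A s) T yA yB) T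
            then (1:ℝ) else 0) := by
    unfold coll
    rw [Finset.mul_sum]
    refine Finset.sum_congr rfl fun s _ => ?_
    rw [Finset.mul_sum]
    refine Finset.sum_congr rfl fun s' _ => ?_
    exact (sum_glue (A s) T (fun y => if pos (A s) y T = pos (A s') y T then (1:ℝ) else 0)).symm
  -- (3) the free collision term
  have hM1 : ∀ (s : σ) (yA : Oracle N),
      ∑ s' : σ, ∑ yB : Oracle N, (if pos (A s) yA T = pos (A s') yB T then (1:ℝ) else 0) ≤ L := by
    intro s yA
    have : ∑ s' : σ, ∑ yB : Oracle N, (if pos (A s) yA T = pos (A s') yB T then (1:ℝ) else 0)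
        = cnt A T (pos (A s) yA T) := by
      unfold cnt
      refine Finset.sum_congr rfl fun s' _ => Finset.sum_congr rfl fun yB _ => ?_
      by_cases h : pos (A s) yA T = pos (A s') yB T
      · rw [if_pos h, if_pos h.symm]
      · rw [if_neg h, if_neg fun h' => h h'.symm]
    rw [this]
    exact hlight T le_rfl _
  -- (4) the attachment term
  have hM2 : ∀ (s : σ) (yA : Oracle N), ∀ i < T,
      ∑ s' : σ, ∑ yB : Oracle N,
        (if pos (A s') yB i ∈ readSet (A s) yA T then (1:ℝ) else 0) ≤ T * L := by
    intro s yA i hi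
    have hrw : ∀ (s' : σ) (yB : Oracle N),
        (if pos (A s') yB i ∈ readSet (A s) yA T then (1:ℝ) else 0)
          = ∑ j ∈ readSet (A s) yA T, (if pos (A s') yB i = j then (1:ℝ) else 0) :=
      fun s' yB => (Finset.sum_ite_eq (readSet (A s) yA T) (pos (A s') yB i) fun _ => (1:ℝ)).symm
    calc ∑ s' : σ, ∑ yB : Oracle N,
          (if pos (A s') yB i ∈ readSet (A s) yA T then (1:ℝ) else 0)
        = ∑ s' : σ, ∑ yB : Oracle N, ∑ j ∈ readSet (A s) yA T,
            (if pos (A s') yB i = j then (1:ℝ) else 0) := by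
          simp only [hrw]
      _ = ∑ s' : σ, ∑ j ∈ readSet (A s) yA T, ∑ yB : Oracle N,
            (if pos (A s') yB i = j then (1:ℝ) else 0) :=
          Finset.sum_congr rfl fun s' _ => Finset.sum_comm
      _ = ∑ j ∈ readSet (A s) yA T, cnt A i j := by
          unfold cnt
          exact Finset.sum_comm
      _ ≤ ∑ j ∈ readSet (A s) yA T, L := Finset.sum_le_sum fun j _ => hlight i hi.le j
      _ = (readSet (A s) yA T).card * L := by rw [Finset.sum_const, nsmul_eq_mul]
      _ ≤ T * L := by
          have hc : ((readSet (A s) yA T).card : ℝ) ≤ T := by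
            exact_mod_cast card_readSet_le (A s) yA T
          exact mul_le_mul_of_nonneg_right hc hLnn
  -- (5) assemble
  have hinner : ∀ (s : σ) (yA : Oracle N),
      ∑ s' : σ, ∑ yB : Oracle N,
        ((if pos (A s) yA T = pos (A s') yB T then (1:ℝ) else 0)
          + ∑ i ∈ Finset.range T,
              (if pos (A s') yB i ∈ readSet (A s) yA T then (1:ℝ) else 0))
        ≤ L + T * (T * L) := by
    intro s yA
    have hsplit : ∑ s' : σ, ∑ yB : Oracle N,
        ((if pos (A s) yA T = pos (A s') yB T then (1:ℝ) else 0)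
          + ∑ i ∈ Finset.range T,
              (if pos (A s') yB i ∈ readSet (A s) yA T then (1:ℝ) else 0))
        = (∑ s' : σ, ∑ yB : Oracle N, (if pos (A s) yA T = pos (A s') yB T then (1:ℝ) else 0))
          + ∑ i ∈ Finset.range T, ∑ s' : σ, ∑ yB : Oracle N,
              (if pos (A s') yB i ∈ readSet (A s) yA T then (1:ℝ) else 0) := by
      have h2 : ∑ s' : σ, ∑ yB : Oracle N, ∑ i ∈ Finset.range T,
            (if pos (A s') yB i ∈ readSet (A s) yA T then (1:ℝ) else 0)
          = ∑ i ∈ Finset.range T, ∑ s' : σ, ∑ yB : Oracle N,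
            (if pos (A s') yB i ∈ readSet (A s) yA T then (1:ℝ) else 0) := by
        calc ∑ s' : σ, ∑ yB : Oracle N, ∑ i ∈ Finset.range T,
              (if pos (A s') yB i ∈ readSet (A s) yA T then (1:ℝ) else 0)
            = ∑ s' : σ, ∑ i ∈ Finset.range T, ∑ yB : Oracle N,
                (if pos (A s') yB i ∈ readSet (A s) yA T then (1:ℝ) else 0) :=
              Finset.sum_congr rfl fun s' _ => Finset.sum_comm
          _ = _ := Finset.sum_comm
      rw [← h2]
      simp only [Finset.sum_add_distrib]
    rw [hsplit]
    have h1 := hM1 s yA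
    have h2 : ∑ i ∈ Finset.range T, ∑ s' : σ, ∑ yB : Oracle N,
        (if pos (A s') yB i ∈ readSet (A s) yA T then (1:ℝ) else 0)
        ≤ ∑ i ∈ Finset.range T, (T : ℝ) * L :=
      Finset.sum_le_sum fun i hi => hM2 s yA i (Finset.mem_range.1 hi)
    rw [Finset.sum_const, Finset.card_range, nsmul_eq_mul] at h2
    linarith
  have htot : (2:ℝ) ^ N * coll A T ≤ ∑ s : σ, ∑ yA : Oracle N, (L + T * (T * L)) := by
    rw [hkey]
    calc ∑ s : σ, ∑ s' : σ, ∑ yA : Oracle N, ∑ yB : Oracle N,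
          (if pos (A s) (glue (A s) T yA yB) T = pos (A s') (glue (A s) T yA yB) T
            then (1:ℝ) else 0)
        = ∑ s : σ, ∑ yA : Oracle N, ∑ s' : σ, ∑ yB : Oracle N,
          (if pos (A s) (glue (A s) T yA yB) T = pos (A s') (glue (A s) T yA yB) T
            then (1:ℝ) else 0) := Finset.sum_congr rfl fun s _ => Finset.sum_comm
      _ ≤ ∑ s : σ, ∑ yA : Oracle N, ∑ s' : σ, ∑ yB : Oracle N,
          ((if pos (A s) yA T = pos (A s') yB T then (1:ℝ) else 0)
            + ∑ i ∈ Finset.range T,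
                (if pos (A s') yB i ∈ readSet (A s) yA T then (1:ℝ) else 0)) :=
          Finset.sum_le_sum fun s _ => Finset.sum_le_sum fun yA _ =>
            Finset.sum_le_sum fun s' _ => Finset.sum_le_sum fun yB _ => hpt s s' yA yB
      _ ≤ ∑ s : σ, ∑ yA : Oracle N, (L + T * (T * L)) :=
          Finset.sum_le_sum fun s _ => Finset.sum_le_sum fun yA _ => hinner s yA
  have hconst : ∑ _s : σ, ∑ _yA : Oracle N, (L + T * (T * L))
      = (Fintype.card σ : ℝ) * (2 ^ N * (L + T * (T * L))) := by
    rw [Finset.sum_const, Finset.card_univ, Finset.sum_const, Finset.card_univ, card_oracle]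
    simp only [nsmul_eq_mul]
    push_cast
    ring
  rw [hconst] at htot
  have h2N : (0:ℝ) < 2 ^ N := by positivity
  have hmain : coll A T ≤ Fintype.card σ * (L + T * (T * L)) := by
    have : (2:ℝ) ^ N * coll A T ≤ (2:ℝ) ^ N * (Fintype.card σ * (L + T * (T * L))) := by
      calc (2:ℝ) ^ N * coll A T ≤ Fintype.card σ * (2 ^ N * (L + T * (T * L))) := htot
        _ = (2:ℝ) ^ N * (Fintype.card σ * (L + T * (T * L))) := by ring
    exact le_of_mul_le_mul_left this h2N
  calc coll A T ≤ Fintype.card σ * (L + T * (T * L)) := hmain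
    _ = lam * (1 + (T : ℝ) ^ 2) * (Fintype.card σ : ℝ) ^ 2 * 2 ^ N := by rw [hL_def]; ring

end Summit.QuantumAdvantage.QuantumAdvantage.Theorems.ClassicalReplica
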